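import Mathlib
import Summits.ValiantsHypothesis.ValiantsHypothesis.Theorems.BorderApolarityToricWitnessObstructionQPStubTorusBound

/-!
# `ConfusionCovering` (crux dir `OrbitDimensionBound`, stmt-ValiantsHypothesis-16133, route FreeSubtorus):
# the CLASS COUNT at the middle level (the stub `stub_classCount`, in tree vocabulary)

Registered stub 3 (`stub_classCount`, size M) of the line `confusion_covering` of the rung `ConfusionCovering`, with the
Cruxes-local confusion number `κ_{⌊n/2⌋}(Λ) = max_q classCount(q)` UNFOLDED: the conclusion exhibits one level-`⌊n/2⌋`
pair `q` whose confusion class (pairs `p` of the same level whose indicator characters are congruent to that of `q`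
modulo `span_ℚ Λ`) has `C(n, ⌊n/2⌋) ≤ m · #class(q)`; since `#class(q) ≤ κ` by definition this is the registered stub.

**Statement (`stub_classCount`).**  If `γ₀ ≠ 0`, `(d, e)` separates characters exactly modulo `Λ_sat`, and an
endomorphism `g` of `ℂ^m` has, for every `σ ∈ 𝔖_n`, a non-zero generalised eigenspace at `γ₀ ∏_{k ∈ I} d_k e_{σ k}`
for some `⌊n/2⌋`-set `I`, then `C(n, ⌊n/2⌋) ≤ m · #class(q)` for some level-`⌊n/2⌋` pair `q`.

**Proof.**  Let `W` be the set of level pairs `(I, J)` whose weight `γ₀ ∏_{I} d ∏_{J} e` occurs.  A pair serves only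
the `⌊n/2⌋! (n - ⌊n/2⌋)!` permutations with `σ(I) = J`, so `|W| ≥ C(n, ⌊n/2⌋)` (pigeonhole over `𝔖_n`, as in
`torusBound_levelCount`).  Occurring weights are `≤ m` (independent generalised eigenspaces), and two pairs of `W`
with the same weight are confused (exact separation), so each weight class of `W` lies in one confusion class:
`|W| ≤ m · max_q #class(q)`. [cite: LandsbergRessayre2017, §6]
-/

open Finset Module.End

-- the mandated summit-side namespace repeats a component by design (single-problem summit)
set_option linter.dupNamespace false

namespace Summit.ValiantsHypothesis.ValiantsHypothesis.Theorems.FreeSubtorusConfusionCovering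

noncomputable section

/-- Equal weights `∏_{I} d ∏_{J} e = ∏_{I'} d ∏_{J'} e` of two pairs give the character identity
`∏_k d_k^{1_I - 1_{I'}} ∏_l e_l^{1_J - 1_{J'}} = 1` in `(ℂˣ)`. [folklore] -/
theorem char_eq_one_of_wt_eq {n : ℕ} (d e : Fin n → ℂˣ) (p q : Finset (Fin n) × Finset (Fin n))
    (h : (∏ k ∈ p.1, (d k : ℂ)) * (∏ l ∈ p.2, (e l : ℂ)) = (∏ k ∈ q.1, (d k : ℂ)) * ∏ l ∈ q.2, (e l : ℂ)) :
    (∏ k, (d k) ^ ((Sum.elim (fun k => if k ∈ p.1 then (1 : ℤ) else 0) (fun l => if l ∈ p.2 then (1 : ℤ) else 0)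
        (Sum.inl k) : ℤ) -
        (Sum.elim (fun k => if k ∈ q.1 then (1 : ℤ) else 0) (fun l => if l ∈ q.2 then (1 : ℤ) else 0) (Sum.inl k) : ℤ))) *
      (∏ l, (e l) ^ ((Sum.elim (fun k => if k ∈ p.1 then (1 : ℤ) else 0) (fun l => if l ∈ p.2 then (1 : ℤ) else 0)
        (Sum.inr l) : ℤ) -
        (Sum.elim (fun k => if k ∈ q.1 then (1 : ℤ) else 0) (fun l => if l ∈ q.2 then (1 : ℤ) else 0) (Sum.inr l) : ℤ))) =
      1 := by
  classical
  simp only [Sum.elim_inl, Sum.elim_inr]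
  -- indicator powers are products over the sets
  have hind : ∀ (f : Fin n → ℂˣ) (s : Finset (Fin n)),
      (∏ k, f k ^ (if k ∈ s then (1 : ℤ) else 0)) = ∏ k ∈ s, f k := by
    intro f s
    calc (∏ k, f k ^ (if k ∈ s then (1 : ℤ) else 0)) = ∏ k, (if k ∈ s then f k else 1) :=
          Finset.prod_congr rfl fun k _ => by split_ifs <;> simp
      _ = ∏ k ∈ s, f k := by rw [Finset.prod_ite_mem, Finset.univ_inter]
  have hval : ∀ (f : Fin n → ℂˣ) (s : Finset (Fin n)), ((∏ k ∈ s, f k : ℂˣ) : ℂ) = ∏ k ∈ s, (f k : ℂ) :=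
    fun f s => Units.coe_prod _ _
  have hU : (∏ k ∈ p.1, d k) * (∏ l ∈ p.2, e l) = (∏ k ∈ q.1, d k) * ∏ l ∈ q.2, e l := by
    apply Units.val_injective
    simp only [Units.val_mul, hval]
    exact h
  simp only [zpow_sub, Finset.prod_mul_distrib, Finset.prod_inv_distrib, hind]
  rw [mul_mul_mul_comm, hU, ← mul_inv, mul_inv_cancel]

open Classical in
/-- **The class count at the middle level (stub `stub_classCount`, confusion number unfolded).**  See the module
docstring. [cite: LandsbergRessayre2017, §6] -/
theorem stub_classCount :
    ∀ (n m r : ℕ) (Λ : Fin r → (Fin n ⊕ Fin n) → ℤ) (d e : Fin n → ℂˣ) (γ₀ : ℂ)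
    (g : Matrix (Fin m) (Fin m) ℂ),
    γ₀ ≠ 0 →
    (∀ χ : (Fin n ⊕ Fin n) → ℤ,
      (∏ k, (d k) ^ (χ (Sum.inl k))) * (∏ l, (e l) ^ (χ (Sum.inr l))) = 1 →
      ∃ (N : ℤ) (a : Fin r → ℤ), N ≠ 0 ∧ N • χ = ∑ i, a i • Λ i) →
    (∀ σ : Equiv.Perm (Fin n), ∃ I : Finset (Fin n), I.card = n / 2 ∧
      Module.End.maxGenEigenspace (Matrix.toLin' g)
        (γ₀ * ∏ k ∈ I, ((d k : ℂ) * (e (σ k) : ℂ))) ≠ ⊥) →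
    ∃ q : Finset (Fin n) × Finset (Fin n), q.1.card = n / 2 ∧ q.2.card = n / 2 ∧
      n.choose (n / 2) ≤ m * (univ.filter fun p : Finset (Fin n) × Finset (Fin n) =>
        p.1.card = n / 2 ∧ p.2.card = n / 2 ∧
        ∃ c : Fin r → ℚ, ∀ x : Fin n ⊕ Fin n,
          ((Sum.elim (fun k => if k ∈ p.1 then (1 : ℤ) else 0) (fun l => if l ∈ p.2 then (1 : ℤ) else 0) x : ℤ) : ℚ) -
          ((Sum.elim (fun k => if k ∈ q.1 then (1 : ℤ) else 0) (fun l => if l ∈ q.2 then (1 : ℤ) else 0) x : ℤ) : ℚ)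
            = ∑ i, c i * ((Λ i x : ℤ) : ℚ)).card := by
  intro n m r Λ d e γ₀ g hγ₀ hsep hserved
  classical
  -- notation
  set lvl := n / 2 with hlvl
  set ind : Finset (Fin n) × Finset (Fin n) → (Fin n ⊕ Fin n) → ℤ := fun p =>
    Sum.elim (fun k => if k ∈ p.1 then (1 : ℤ) else 0) (fun l => if l ∈ p.2 then (1 : ℤ) else 0) with hind
  set Conf : Finset (Fin n) × Finset (Fin n) → Finset (Fin n) × Finset (Fin n) → Prop := fun p q =>
    ∃ c : Fin r → ℚ, ∀ x : Fin n ⊕ Fin n, ((ind p x : ℤ) : ℚ) - ((ind q x : ℤ) : ℚ) = ∑ i, c i * ((Λ i x : ℤ) : ℚ)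
    with hConf
  set cc : Finset (Fin n) × Finset (Fin n) → ℕ := fun q =>
    (univ.filter fun p : Finset (Fin n) × Finset (Fin n) => p.1.card = lvl ∧ p.2.card = lvl ∧ Conf p q).card with hcc
  set wt : Finset (Fin n) × Finset (Fin n) → ℂ := fun p =>
    γ₀ * ((∏ k ∈ p.1, (d k : ℂ)) * ∏ l ∈ p.2, (e l : ℂ)) with hwt
  set E : ℂ → Submodule ℂ (Fin m → ℂ) := fun β => Module.End.maxGenEigenspace (Matrix.toLin' g) β with hE
  set W : Finset (Finset (Fin n) × Finset (Fin n)) :=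
    univ.filter fun p => p.1.card = lvl ∧ p.2.card = lvl ∧ E (wt p) ≠ ⊥ with hW
  -- the target pair: a maximiser of the class count among level pairs
  set L : Finset (Finset (Fin n) × Finset (Fin n)) := univ.filter fun q => q.1.card = lvl ∧ q.2.card = lvl with hL
  have hLne : L.Nonempty := by
    obtain ⟨S, hS⟩ : ((univ : Finset (Fin n)).powersetCard lvl).Nonempty := by
      rw [Finset.powersetCard_nonempty, card_univ, Fintype.card_fin]; exact Nat.div_le_self n 2
    have hSc : S.card = lvl := (Finset.mem_powersetCard.1 hS).2
    exact ⟨(S, S), mem_filter.2 ⟨mem_univ _, hSc, hSc⟩⟩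
  obtain ⟨q₀, hq₀L, hq₀⟩ := Finset.exists_mem_eq_sup L hLne cc
  have hq₀lvl := (mem_filter.1 hq₀L).2
  refine ⟨q₀, hq₀lvl.1, hq₀lvl.2, ?_⟩
  show n.choose lvl ≤ m * cc q₀
  rw [← hq₀]
  -- Step 1: `C(n, lvl) ≤ |W|` (pigeonhole over `𝔖_n`)
  have h1 : n.choose lvl ≤ W.card := by
    choose I hI hEI using hserved
    let f : Equiv.Perm (Fin n) → Finset (Fin n) × Finset (Fin n) := fun σ => (I σ, (I σ).map σ.toEmbedding)
    have hf : ∀ σ ∈ (univ : Finset (Equiv.Perm (Fin n))), f σ ∈ W := fun σ _ => by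
      simp only [hW, mem_filter, mem_univ, true_and, f, card_map]
      refine ⟨hI σ, hI σ, ?_⟩
      have : wt (I σ, (I σ).map σ.toEmbedding) = γ₀ * ∏ k ∈ I σ, ((d k : ℂ) * (e (σ k) : ℂ)) := by
        simp only [hwt, Finset.prod_map, Equiv.coe_toEmbedding, Finset.prod_mul_distrib]
      rw [this]
      exact hEI σ
    have hfib : ∀ b ∈ W, (univ.filter fun σ => f σ = b).card ≤ lvl.factorial * (n - lvl).factorial := by
      rintro ⟨I₀, J₀⟩ hb
      have hI₀ : I₀.card = lvl := (mem_filter.1 hb).2.1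
      calc (univ.filter fun σ => f σ = (I₀, J₀)).card
          ≤ (univ.filter fun σ : Equiv.Perm (Fin n) => I₀.map σ.toEmbedding = J₀).card := by
            refine card_le_card fun σ hσ => ?_
            simp only [mem_filter, mem_univ, true_and, f, Prod.mk.injEq] at hσ ⊢
            rw [← hσ.1]
            exact hσ.2
        _ ≤ lvl.factorial * (n - lvl).factorial := by
            rw [← hI₀]; exact BorderApolarityToricWitnessObstructionQP.torusBound_card_perm_map_le I₀ J₀
    have hcount := card_le_mul_card_image_of_maps_to hf _ hfib
    rw [card_univ, Fintype.card_perm, Fintype.card_fin] at hcount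
    refine Nat.le_of_mul_le_mul_right ?_ (Nat.mul_pos (Nat.factorial_pos lvl) (Nat.factorial_pos (n - lvl)))
    calc n.choose lvl * (lvl.factorial * (n - lvl).factorial) = n.factorial := by
          rw [← mul_assoc, Nat.choose_mul_factorial_mul_factorial (Nat.div_le_self n 2)]
      _ ≤ lvl.factorial * (n - lvl).factorial * W.card := hcount
      _ = W.card * (lvl.factorial * (n - lvl).factorial) := mul_comm _ _
  -- Step 2a: at most `m` weights occur
  set Ω := W.image wt with hΩ
  have h2a : Ω.card ≤ m := by
    have hind' : iSupIndep (fun ω : ↥Ω => E (ω : ℂ)) :=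
      (Module.End.independent_maxGenEigenspace (Matrix.toLin' g)).comp Subtype.val_injective
    have hne : ∀ ω : ↥Ω, (fun ω : ↥Ω => E (ω : ℂ)) ω ≠ ⊥ := by
      rintro ⟨ω, hω⟩
      obtain ⟨p, hp, rfl⟩ := mem_image.1 hω
      exact (mem_filter.1 hp).2.2.2
    have := hind'.subtype_ne_bot_le_finrank
    rwa [Fintype.card_congr (Equiv.subtypeUnivEquiv hne), Fintype.card_coe, Module.finrank_fin_fun] at this
  -- Step 2b: a weight class of `W` lies in one confusion class
  have h2b : ∀ ω ∈ Ω, (W.filter fun p => wt p = ω).card ≤ L.sup cc := by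
    intro ω hω
    obtain ⟨q, hq, rfl⟩ := mem_image.1 hω
    have hqL : q ∈ L := mem_filter.2 ⟨mem_univ _, (mem_filter.1 hq).2.1, (mem_filter.1 hq).2.2.1⟩
    refine le_trans (?_ : _ ≤ cc q) (Finset.le_sup (f := cc) hqL)
    refine card_le_card fun p hp => ?_
    have hpW := (mem_filter.1 hp).1
    have hpq : wt p = wt q := (mem_filter.1 hp).2
    refine mem_filter.2 ⟨mem_univ _, (mem_filter.1 hpW).2.1, (mem_filter.1 hpW).2.2.1, ?_⟩
    -- exact separation
    have hprod : (∏ k ∈ p.1, (d k : ℂ)) * (∏ l ∈ p.2, (e l : ℂ)) = (∏ k ∈ q.1, (d k : ℂ)) * ∏ l ∈ q.2, (e l : ℂ) :=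
      mul_left_cancel₀ hγ₀ hpq
    obtain ⟨N, a, hN, hNa⟩ := hsep (ind p - ind q) (by
      have := char_eq_one_of_wt_eq d e p q hprod
      simpa only [hind, Pi.sub_apply] using this)
    refine ⟨fun i => (a i : ℚ) / N, fun x => ?_⟩
    have hx := congrFun hNa x
    simp only [Pi.smul_apply, Finset.sum_apply, smul_eq_mul, Pi.sub_apply] at hx
    have hxQ : (N : ℚ) * (((ind p x : ℤ) : ℚ) - ((ind q x : ℤ) : ℚ)) = ∑ i, (a i : ℚ) * ((Λ i x : ℤ) : ℚ) := by
      exact_mod_cast hx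
    have hNQ : (N : ℚ) ≠ 0 := by exact_mod_cast hN
    have hdiv : ((ind p x : ℤ) : ℚ) - ((ind q x : ℤ) : ℚ) = (∑ i, (a i : ℚ) * ((Λ i x : ℤ) : ℚ)) / N :=
      (eq_div_iff hNQ).2 (by rw [mul_comm]; exact hxQ)
    rw [hdiv, Finset.sum_div]
    exact Finset.sum_congr rfl fun i _ => by ring
  -- Step 2c: sum over the weights
  have h2 : W.card ≤ m * L.sup cc := by
    rw [Finset.card_eq_sum_card_image wt W]
    calc ∑ ω ∈ Ω, (W.filter fun p => wt p = ω).card ≤ ∑ _ω ∈ Ω, L.sup cc := Finset.sum_le_sum h2b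
      _ = Ω.card * L.sup cc := by rw [Finset.sum_const, smul_eq_mul]
      _ ≤ m * L.sup cc := Nat.mul_le_mul_right _ h2a
  exact h1.trans h2

end

end Summit.ValiantsHypothesis.ValiantsHypothesis.Theorems.FreeSubtorusConfusionCovering
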